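import Summits.CriticalPhenomena.PercolationContinuityZ3.Theorems.PercNearOneGluingNoHeavyLowerTailSahiThreeCopyPolarizationCases

/-!
# `NoHeavyLowerTail` (crux stmt-CriticalPhenomena-4575), Sahi programme: **THE SLICE LAW ON THE 2×2 GRID OF DOUBLE SECTIONS** —
# (SC) one dimension up, written on grid data `a ≤ b ≤ e`, `a ≤ c ≤ e` of the `d`-cube, and its consequences for CHAINS obtained by
# interleaved gluing: the STRONG CHAIN LAW `2T(t₁;t₂;t₃) ≥ max(T(t₂;t₂;t₃), T(t₁;t₃;t₃))` and three chain inequalities that are NOT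
# nonnegative combinations of {3C, (SC) on level pairs, third differences}

Support file (Sahi cell, seat `prim-sahi-p1`, generation 57; `--supports stmt-CriticalPhenomena-4575`); companion of `…SahiThreeCopyPolarization`
(`tcp6 = 6T`) and `…PolarizationCases` (`glue`, `sliceLaw_sections`, the chain identity).  Pure proofs; no `sorry`, standard axioms; the slice law
(SC) (`SliceLaw`, OPEN) enters only as a hypothesis.

THE POINT (memo FROM-prim-sahi-p1-gen57 §3/§3bis).  A monotone triple on `d+2` coordinates has four double sections `t^{00} = a`, `t^{01} = b`,
`t^{10} = c`, `t^{11} = e` with `a ≤ b ≤ e`, `a ≤ c ≤ e` (`b`, `c` incomparable), and its two-coordinate slices are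
`6c_{(2,1)} = 6·6T(a;c;e) + 3·6T(b;c;c)`, `6c_{(2,2)} = 3·6T(a;e;e) + 6·6T(b;c;e)` etc.; the slice law along `x₀` therefore reads, on the grid,
* ★ `sliceLaw_grid21`: **`6·6T(c;c;e) ≤ 6·6T(a;c;e) + 3·6T(b;c;c)`** (x₁-profile 1) and
* ★ `sliceLaw_grid22`: **`6·6T(c;e;e) ≤ 3·6T(a;e;e) + 6·6T(b;c;e)`** (x₁-profile 2),
for all grid data of nonnegative monotone triples on the `d`-cube (glue `P = glue a b ≤ Q = glue c e` and apply `sliceLaw_sections` one dimension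
up, then `tcp6_cons_one/two`).  These two inequalities are exactly what (SC) in dimension `d+1` says beyond dimension `d`; the Λ-configuration
`T(b;c;e)` and the mixed `T(b;c;c)` of the incomparable pair are what they control (kit j335867: they are NOT linear consequences of chain-type
facts about the grid's sub-chains, even with all three-increment positivity atoms).
CONSEQUENCES FOR CHAINS `t₁ ≤ t₂ ≤ t₃` (grids need not have `b, c` incomparable):
* ★ `sliceLaw_chain_half223` (grid `(t₁,t₃,t₂,t₃)`): **`3·6T(t₂;t₂;t₃) ≤ 6·6T(t₁;t₂;t₃)`**, and `sliceLaw_chain_half133` (grid `(t₁,t₂,t₁,t₃)`):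
  **`3·6T(t₁;t₃;t₃) ≤ 6·6T(t₁;t₂;t₃)`** — the STRONG CHAIN LAW `T(t₁;t₂;t₃) ≥ ½·max(T(t₂;t₂;t₃), T(t₁;t₃;t₃)) ≥ 0` (sharper than
  `polarizedChainLaw_of_sliceLaw`; these two happen to be nonnegative combinations of 3C, (SC) on level pairs and third differences).
* ★ `sliceLaw_chain_glued_122` (grid `(t₁,t₁,t₂,t₃)`): `6·6T(t₂;t₂;t₃) ≤ 6·6T(t₁;t₂;t₃) + 3·6T(t₁;t₂;t₂)`; `sliceLaw_chain_glued_222` (grid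
  `(t₁,t₂,t₂,t₃)`): `6·6T(t₂;t₂;t₃) ≤ 6·6T(t₁;t₂;t₃) + 3·6T(t₂;t₂;t₂)`; `sliceLaw_chain_glued_133` (grid `(t₁,t₁,t₂,t₃)`, profile 2):
  `6·6T(t₂;t₃;t₃) ≤ 3·6T(t₁;t₃;t₃) + 6·6T(t₁;t₂;t₃)`.  In the basis {3C_k, SC_kl, D_{δδδ},D_{δδε},D_{δεε},D_{εεε}} of linear functionals on the
  ten chain values these three have the coefficient −1 on `SC₂₃` (memo §3: exact computation) — so the cone of chain vectors is NOT the
  simplicial cone cut out by {3C, SC, third differences}: (SC) applied to INTERLEAVED GLUINGS produces further facets (this corrects the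
  'simplicial chain cone' guess recorded earlier in generation 57).  [this work]
-/

namespace Summit.CriticalPhenomena.PercolationContinuityZ3.Theorems.SahiThreeCopy

open Finset Function Literature.Combinatorics.Sahi2008
open scoped BigOperators

noncomputable section

variable {d : ℕ}

/-- `glue` is monotone in both pieces (pointwise). [this work] -/
theorem glue_le_glue {lo hi lo' hi' : Pt d → ℝ} (h1 : ∀ x, lo x ≤ lo' x) (h2 : ∀ x, hi x ≤ hi' x) :
    ∀ x, glue lo hi x ≤ glue lo' hi' x := by
  intro x; unfold glue; split_ifs
  · exact h2 _
  · exact h1 _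

/-! ### §1 The slice law on the grid -/

/-- ★ **(SC) on the grid, x₁-profile 1**: for grid data `a ≤ b ≤ e`, `a ≤ c ≤ e` of nonnegative monotone triples on the `d`-cube and every
profile, `6·6T(c;c;e) ≤ 6·6T(a;c;e) + 3·6T(b;c;c)`. [this work] -/
theorem sliceLaw_grid21 (hSC : SliceLaw) (b : Fin d → ℕ)
    {fa ga ha fb gb hb fc gc hc fe ge he : Pt d → ℝ}
    (hfa : ∀ x, 0 ≤ fa x) (hga : ∀ x, 0 ≤ ga x) (hha : ∀ x, 0 ≤ ha x)
    (hfam : Monotone fa) (hgam : Monotone ga) (hham : Monotone ha) (hfbm : Monotone fb) (hgbm : Monotone gb) (hhbm : Monotone hb)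
    (hfcm : Monotone fc) (hgcm : Monotone gc) (hhcm : Monotone hc) (hfem : Monotone fe) (hgem : Monotone ge) (hhem : Monotone he)
    (fab : ∀ x, fa x ≤ fb x) (gab : ∀ x, ga x ≤ gb x) (hab : ∀ x, ha x ≤ hb x)
    (fac : ∀ x, fa x ≤ fc x) (gac : ∀ x, ga x ≤ gc x) (hac : ∀ x, ha x ≤ hc x)
    (fbe : ∀ x, fb x ≤ fe x) (gbe : ∀ x, gb x ≤ ge x) (hbe : ∀ x, hb x ≤ he x)
    (fce : ∀ x, fc x ≤ fe x) (gce : ∀ x, gc x ≤ ge x) (hce : ∀ x, hc x ≤ he x) :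
    6 * tcp6 b fc gc hc fc gc hc fe ge he ≤ 6 * tcp6 b fa ga ha fc gc hc fe ge he + 3 * tcp6 b fb gb hb fc gc hc fc gc hc := by
  have hPf := glue_nonneg hfa (fun x => (hfa x).trans (fab x))
  have hPg := glue_nonneg hga (fun x => (hga x).trans (gab x))
  have hPh := glue_nonneg hha (fun x => (hha x).trans (hab x))
  have hPfm := glue_monotone hfam hfbm fab; have hPgm := glue_monotone hgam hgbm gab; have hPhm := glue_monotone hham hhbm hab
  have hQfm := glue_monotone hfcm hfem fce; have hQgm := glue_monotone hgcm hgem gce; have hQhm := glue_monotone hhcm hhem hce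
  have key := sliceLaw_sections hSC (Fin.cons 1 b : Fin (d + 1) → ℕ) hPf hPg hPh hPfm hPgm hPhm hQfm hQgm hQhm
    (glue_le_glue fac fbe) (glue_le_glue gac gbe) (glue_le_glue hac hbe)
  rw [tcp6_cons_one, tcp6_cons_one] at key
  simp only [sec_glue_false, sec_glue_true] at key
  have e1 := tcp6_swap13 b fe ge he fc gc hc fc gc hc
  have e2 := tcp6_swap12 b fc gc hc fe ge he fc gc hc
  have e3 := tcp6_swap23 b fa ga ha fe ge he fc gc hc
  linarith

/-- ★ **(SC) on the grid, x₁-profile 2**: `6·6T(c;e;e) ≤ 3·6T(a;e;e) + 6·6T(b;c;e)`. [this work] -/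
theorem sliceLaw_grid22 (hSC : SliceLaw) (b : Fin d → ℕ)
    {fa ga ha fb gb hb fc gc hc fe ge he : Pt d → ℝ}
    (hfa : ∀ x, 0 ≤ fa x) (hga : ∀ x, 0 ≤ ga x) (hha : ∀ x, 0 ≤ ha x)
    (hfam : Monotone fa) (hgam : Monotone ga) (hham : Monotone ha) (hfbm : Monotone fb) (hgbm : Monotone gb) (hhbm : Monotone hb)
    (hfcm : Monotone fc) (hgcm : Monotone gc) (hhcm : Monotone hc) (hfem : Monotone fe) (hgem : Monotone ge) (hhem : Monotone he)
    (fab : ∀ x, fa x ≤ fb x) (gab : ∀ x, ga x ≤ gb x) (hab : ∀ x, ha x ≤ hb x)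
    (fac : ∀ x, fa x ≤ fc x) (gac : ∀ x, ga x ≤ gc x) (hac : ∀ x, ha x ≤ hc x)
    (fbe : ∀ x, fb x ≤ fe x) (gbe : ∀ x, gb x ≤ ge x) (hbe : ∀ x, hb x ≤ he x)
    (fce : ∀ x, fc x ≤ fe x) (gce : ∀ x, gc x ≤ ge x) (hce : ∀ x, hc x ≤ he x) :
    6 * tcp6 b fc gc hc fe ge he fe ge he ≤ 3 * tcp6 b fa ga ha fe ge he fe ge he + 6 * tcp6 b fb gb hb fc gc hc fe ge he := by
  have hPf := glue_nonneg hfa (fun x => (hfa x).trans (fab x))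
  have hPg := glue_nonneg hga (fun x => (hga x).trans (gab x))
  have hPh := glue_nonneg hha (fun x => (hha x).trans (hab x))
  have hPfm := glue_monotone hfam hfbm fab; have hPgm := glue_monotone hgam hgbm gab; have hPhm := glue_monotone hham hhbm hab
  have hQfm := glue_monotone hfcm hfem fce; have hQgm := glue_monotone hgcm hgem gce; have hQhm := glue_monotone hhcm hhem hce
  have key := sliceLaw_sections hSC (Fin.cons 2 b : Fin (d + 1) → ℕ) hPf hPg hPh hPfm hPgm hPhm hQfm hQgm hQhm
    (glue_le_glue fac fbe) (glue_le_glue gac gbe) (glue_le_glue hac hbe)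
  rw [tcp6_cons_two, tcp6_cons_two] at key
  simp only [sec_glue_false, sec_glue_true] at key
  have e1 := tcp6_swap12 b fe ge he fc gc hc fe ge he
  have e2 := tcp6_swap13 b fe ge he fe ge he fc gc hc
  have e3 := tcp6_swap23 b fb gb hb fe ge he fc gc hc
  linarith

/-! ### §2 Consequences for chains by interleaved gluing -/

/-- ★ **Strong chain law, first half**: (SC) ⇒ `3·6T(t₂;t₂;t₃) ≤ 6·6T(t₁;t₂;t₃)` for chains `t₁ ≤ t₂ ≤ t₃` of nonnegative monotone triples
(`sliceLaw_grid21` for the grid `(t₁, t₃, t₂, t₃)`). [this work] -/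
theorem sliceLaw_chain_half223 (hSC : SliceLaw) (b : Fin d → ℕ) {f₁ g₁ h₁ f₂ g₂ h₂ f₃ g₃ h₃ : Pt d → ℝ}
    (hf₁ : ∀ x, 0 ≤ f₁ x) (hg₁ : ∀ x, 0 ≤ g₁ x) (hh₁ : ∀ x, 0 ≤ h₁ x)
    (hf₁m : Monotone f₁) (hg₁m : Monotone g₁) (hh₁m : Monotone h₁) (hf₂m : Monotone f₂) (hg₂m : Monotone g₂) (hh₂m : Monotone h₂)
    (hf₃m : Monotone f₃) (hg₃m : Monotone g₃) (hh₃m : Monotone h₃)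
    (hf₁₂ : ∀ x, f₁ x ≤ f₂ x) (hg₁₂ : ∀ x, g₁ x ≤ g₂ x) (hh₁₂ : ∀ x, h₁ x ≤ h₂ x)
    (hf₂₃ : ∀ x, f₂ x ≤ f₃ x) (hg₂₃ : ∀ x, g₂ x ≤ g₃ x) (hh₂₃ : ∀ x, h₂ x ≤ h₃ x) :
    3 * tcp6 b f₂ g₂ h₂ f₂ g₂ h₂ f₃ g₃ h₃ ≤ 6 * tcp6 b f₁ g₁ h₁ f₂ g₂ h₂ f₃ g₃ h₃ := by
  have hf₁₃ := fun x => (hf₁₂ x).trans (hf₂₃ x); have hg₁₃ := fun x => (hg₁₂ x).trans (hg₂₃ x); have hh₁₃ := fun x => (hh₁₂ x).trans (hh₂₃ x)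
  have k := sliceLaw_grid21 hSC b (fa := f₁) (ga := g₁) (ha := h₁) (fb := f₃) (gb := g₃) (hb := h₃) (fc := f₂) (gc := g₂) (hc := h₂)
    (fe := f₃) (ge := g₃) (he := h₃) hf₁ hg₁ hh₁ hf₁m hg₁m hh₁m hf₃m hg₃m hh₃m hf₂m hg₂m hh₂m hf₃m hg₃m hh₃m hf₁₃ hg₁₃ hh₁₃ hf₁₂ hg₁₂ hh₁₂
    (fun _ => le_rfl) (fun _ => le_rfl) (fun _ => le_rfl) hf₂₃ hg₂₃ hh₂₃
  have e1 := tcp6_swap13 b f₃ g₃ h₃ f₂ g₂ h₂ f₂ g₂ h₂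
  have e2 := tcp6_swap12 b f₂ g₂ h₂ f₂ g₂ h₂ f₃ g₃ h₃
  linarith

/-- ★ **Strong chain law, second half**: (SC) ⇒ `3·6T(t₁;t₃;t₃) ≤ 6·6T(t₁;t₂;t₃)` for chains (`sliceLaw_grid22` for the grid
`(t₁, t₂, t₁, t₃)`).  With `sliceLaw_chain_half223`: `T(t₁;t₂;t₃) ≥ ½·max(T(t₂;t₂;t₃), T(t₁;t₃;t₃)) ≥ 0`. [this work] -/
theorem sliceLaw_chain_half133 (hSC : SliceLaw) (b : Fin d → ℕ) {f₁ g₁ h₁ f₂ g₂ h₂ f₃ g₃ h₃ : Pt d → ℝ}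
    (hf₁ : ∀ x, 0 ≤ f₁ x) (hg₁ : ∀ x, 0 ≤ g₁ x) (hh₁ : ∀ x, 0 ≤ h₁ x)
    (hf₁m : Monotone f₁) (hg₁m : Monotone g₁) (hh₁m : Monotone h₁) (hf₂m : Monotone f₂) (hg₂m : Monotone g₂) (hh₂m : Monotone h₂)
    (hf₃m : Monotone f₃) (hg₃m : Monotone g₃) (hh₃m : Monotone h₃)
    (hf₁₂ : ∀ x, f₁ x ≤ f₂ x) (hg₁₂ : ∀ x, g₁ x ≤ g₂ x) (hh₁₂ : ∀ x, h₁ x ≤ h₂ x)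
    (hf₂₃ : ∀ x, f₂ x ≤ f₃ x) (hg₂₃ : ∀ x, g₂ x ≤ g₃ x) (hh₂₃ : ∀ x, h₂ x ≤ h₃ x) :
    3 * tcp6 b f₁ g₁ h₁ f₃ g₃ h₃ f₃ g₃ h₃ ≤ 6 * tcp6 b f₁ g₁ h₁ f₂ g₂ h₂ f₃ g₃ h₃ := by
  have hf₁₃ := fun x => (hf₁₂ x).trans (hf₂₃ x); have hg₁₃ := fun x => (hg₁₂ x).trans (hg₂₃ x); have hh₁₃ := fun x => (hh₁₂ x).trans (hh₂₃ x)
  have k := sliceLaw_grid22 hSC b (fa := f₁) (ga := g₁) (ha := h₁) (fb := f₂) (gb := g₂) (hb := h₂) (fc := f₁) (gc := g₁) (hc := h₁)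
    (fe := f₃) (ge := g₃) (he := h₃) hf₁ hg₁ hh₁ hf₁m hg₁m hh₁m hf₂m hg₂m hh₂m hf₁m hg₁m hh₁m hf₃m hg₃m hh₃m hf₁₂ hg₁₂ hh₁₂
    (fun _ => le_rfl) (fun _ => le_rfl) (fun _ => le_rfl) hf₂₃ hg₂₃ hh₂₃ hf₁₃ hg₁₃ hh₁₃
  have e1 := tcp6_swap12 b f₂ g₂ h₂ f₁ g₁ h₁ f₃ g₃ h₃
  linarith

/-- ★ **A glued slice law on chains with a NEGATIVE `SC₂₃`-coefficient** (grid `(t₁,t₁,t₂,t₃)`, profile 1):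
`6·6T(t₂;t₂;t₃) ≤ 6·6T(t₁;t₂;t₃) + 3·6T(t₁;t₂;t₂)`.  In the basis {3C, SC, third differences} this functional is
`3C₂ + 2SC₁₂ + SC₁₃ − SC₂₃ + 3D_{δεε}` — not a nonnegative combination. [this work] -/
theorem sliceLaw_chain_glued_122 (hSC : SliceLaw) (b : Fin d → ℕ) {f₁ g₁ h₁ f₂ g₂ h₂ f₃ g₃ h₃ : Pt d → ℝ}
    (hf₁ : ∀ x, 0 ≤ f₁ x) (hg₁ : ∀ x, 0 ≤ g₁ x) (hh₁ : ∀ x, 0 ≤ h₁ x)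
    (hf₁m : Monotone f₁) (hg₁m : Monotone g₁) (hh₁m : Monotone h₁) (hf₂m : Monotone f₂) (hg₂m : Monotone g₂) (hh₂m : Monotone h₂)
    (hf₃m : Monotone f₃) (hg₃m : Monotone g₃) (hh₃m : Monotone h₃)
    (hf₁₂ : ∀ x, f₁ x ≤ f₂ x) (hg₁₂ : ∀ x, g₁ x ≤ g₂ x) (hh₁₂ : ∀ x, h₁ x ≤ h₂ x)
    (hf₂₃ : ∀ x, f₂ x ≤ f₃ x) (hg₂₃ : ∀ x, g₂ x ≤ g₃ x) (hh₂₃ : ∀ x, h₂ x ≤ h₃ x) :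
    6 * tcp6 b f₂ g₂ h₂ f₂ g₂ h₂ f₃ g₃ h₃ ≤ 6 * tcp6 b f₁ g₁ h₁ f₂ g₂ h₂ f₃ g₃ h₃ + 3 * tcp6 b f₁ g₁ h₁ f₂ g₂ h₂ f₂ g₂ h₂ := by
  have k := sliceLaw_grid21 hSC b (fa := f₁) (ga := g₁) (ha := h₁) (fb := f₁) (gb := g₁) (hb := h₁) (fc := f₂) (gc := g₂) (hc := h₂)
    (fe := f₃) (ge := g₃) (he := h₃) hf₁ hg₁ hh₁ hf₁m hg₁m hh₁m hf₁m hg₁m hh₁m hf₂m hg₂m hh₂m hf₃m hg₃m hh₃m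
    (fun _ => le_rfl) (fun _ => le_rfl) (fun _ => le_rfl) hf₁₂ hg₁₂ hh₁₂ (fun x => (hf₁₂ x).trans (hf₂₃ x))
    (fun x => (hg₁₂ x).trans (hg₂₃ x)) (fun x => (hh₁₂ x).trans (hh₂₃ x)) hf₂₃ hg₂₃ hh₂₃
  have e1 := tcp6_swap13 b f₂ g₂ h₂ f₂ g₂ h₂ f₃ g₃ h₃
  have e2 := tcp6_swap12 b f₂ g₂ h₂ f₃ g₃ h₃ f₂ g₂ h₂
  have e3 := tcp6_swap23 b f₂ g₂ h₂ f₃ g₃ h₃ f₂ g₂ h₂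
  linarith

/-- ★ **Second glued slice law with a negative `SC₂₃`-coefficient** (grid `(t₁,t₂,t₂,t₃)`, profile 1):
`6·6T(t₂;t₂;t₃) ≤ 6·6T(t₁;t₂;t₃) + 3·6T(t₂;t₂;t₂)` (= `2·3C₂ + SC₁₂ + SC₁₃ − SC₂₃ + 3D_{δεε}`). [this work] -/
theorem sliceLaw_chain_glued_222 (hSC : SliceLaw) (b : Fin d → ℕ) {f₁ g₁ h₁ f₂ g₂ h₂ f₃ g₃ h₃ : Pt d → ℝ}
    (hf₁ : ∀ x, 0 ≤ f₁ x) (hg₁ : ∀ x, 0 ≤ g₁ x) (hh₁ : ∀ x, 0 ≤ h₁ x)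
    (hf₁m : Monotone f₁) (hg₁m : Monotone g₁) (hh₁m : Monotone h₁) (hf₂m : Monotone f₂) (hg₂m : Monotone g₂) (hh₂m : Monotone h₂)
    (hf₃m : Monotone f₃) (hg₃m : Monotone g₃) (hh₃m : Monotone h₃)
    (hf₁₂ : ∀ x, f₁ x ≤ f₂ x) (hg₁₂ : ∀ x, g₁ x ≤ g₂ x) (hh₁₂ : ∀ x, h₁ x ≤ h₂ x)
    (hf₂₃ : ∀ x, f₂ x ≤ f₃ x) (hg₂₃ : ∀ x, g₂ x ≤ g₃ x) (hh₂₃ : ∀ x, h₂ x ≤ h₃ x) :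
    6 * tcp6 b f₂ g₂ h₂ f₂ g₂ h₂ f₃ g₃ h₃ ≤ 6 * tcp6 b f₁ g₁ h₁ f₂ g₂ h₂ f₃ g₃ h₃ + 3 * tcp6 b f₂ g₂ h₂ f₂ g₂ h₂ f₂ g₂ h₂ := by
  have k := sliceLaw_grid21 hSC b (fa := f₁) (ga := g₁) (ha := h₁) (fb := f₂) (gb := g₂) (hb := h₂) (fc := f₂) (gc := g₂) (hc := h₂)
    (fe := f₃) (ge := g₃) (he := h₃) hf₁ hg₁ hh₁ hf₁m hg₁m hh₁m hf₂m hg₂m hh₂m hf₂m hg₂m hh₂m hf₃m hg₃m hh₃m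
    hf₁₂ hg₁₂ hh₁₂ hf₁₂ hg₁₂ hh₁₂ hf₂₃ hg₂₃ hh₂₃ hf₂₃ hg₂₃ hh₂₃
  have e1 := tcp6_swap13 b f₂ g₂ h₂ f₂ g₂ h₂ f₃ g₃ h₃
  have e2 := tcp6_swap12 b f₂ g₂ h₂ f₃ g₃ h₃ f₂ g₂ h₂
  have e3 := tcp6_swap23 b f₂ g₂ h₂ f₃ g₃ h₃ f₂ g₂ h₂
  linarith

/-- ★ **Third glued slice law** (grid `(t₁,t₁,t₂,t₃)`, profile 2): `6·6T(t₂;t₃;t₃) ≤ 3·6T(t₁;t₃;t₃) + 6·6T(t₁;t₂;t₃)`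
(= `3C₂ + SC₁₂ + 2SC₁₃ − SC₂₃ + 3D_{δεε} + 2D_{εεε}`). [this work] -/
theorem sliceLaw_chain_glued_133 (hSC : SliceLaw) (b : Fin d → ℕ) {f₁ g₁ h₁ f₂ g₂ h₂ f₃ g₃ h₃ : Pt d → ℝ}
    (hf₁ : ∀ x, 0 ≤ f₁ x) (hg₁ : ∀ x, 0 ≤ g₁ x) (hh₁ : ∀ x, 0 ≤ h₁ x)
    (hf₁m : Monotone f₁) (hg₁m : Monotone g₁) (hh₁m : Monotone h₁) (hf₂m : Monotone f₂) (hg₂m : Monotone g₂) (hh₂m : Monotone h₂)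
    (hf₃m : Monotone f₃) (hg₃m : Monotone g₃) (hh₃m : Monotone h₃)
    (hf₁₂ : ∀ x, f₁ x ≤ f₂ x) (hg₁₂ : ∀ x, g₁ x ≤ g₂ x) (hh₁₂ : ∀ x, h₁ x ≤ h₂ x)
    (hf₂₃ : ∀ x, f₂ x ≤ f₃ x) (hg₂₃ : ∀ x, g₂ x ≤ g₃ x) (hh₂₃ : ∀ x, h₂ x ≤ h₃ x) :
    6 * tcp6 b f₂ g₂ h₂ f₃ g₃ h₃ f₃ g₃ h₃ ≤ 3 * tcp6 b f₁ g₁ h₁ f₃ g₃ h₃ f₃ g₃ h₃ + 6 * tcp6 b f₁ g₁ h₁ f₂ g₂ h₂ f₃ g₃ h₃ := by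
  have k := sliceLaw_grid22 hSC b (fa := f₁) (ga := g₁) (ha := h₁) (fb := f₁) (gb := g₁) (hb := h₁) (fc := f₂) (gc := g₂) (hc := h₂)
    (fe := f₃) (ge := g₃) (he := h₃) hf₁ hg₁ hh₁ hf₁m hg₁m hh₁m hf₁m hg₁m hh₁m hf₂m hg₂m hh₂m hf₃m hg₃m hh₃m
    (fun _ => le_rfl) (fun _ => le_rfl) (fun _ => le_rfl) hf₁₂ hg₁₂ hh₁₂ (fun x => (hf₁₂ x).trans (hf₂₃ x))
    (fun x => (hg₁₂ x).trans (hg₂₃ x)) (fun x => (hh₁₂ x).trans (hh₂₃ x)) hf₂₃ hg₂₃ hh₂₃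
  linarith

end

end Summit.CriticalPhenomena.PercolationContinuityZ3.Theorems.SahiThreeCopy
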